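import Summits.CriticalPhenomena.PercolationContinuityZ3.Theorems.Transplant.FKConnectivityAllQAntipodalContractMain
import Summits.CriticalPhenomena.PercolationContinuityZ3.Theorems.Transplant.FKConnectivityAllQAntipodalLevel3All
import HarnessLib

/-!
# Connectivity correlation inequalities for `φ_{w,q}`, every `q > 0` — file 45a: the level-3 algebra WITH A CONTRACTED SET, and
# Theorem U / AND at any position in every cell

Support file (`--supports stmt-CriticalPhenomena-4575`), FK sub-lane `prim-bschramm-fk-2` (gen 20); builds on p205010 (kernel theorem,
internal audit signed; external expert review pending).  No definitions, no named facts, no sorries; standard axioms.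

File 35's odd-vector reduction for the minor form `apPsiC q M C` (live `M`, contracted `C`): `FK.apPsiC_comm`, `FK.apPsiC_congr_odd`,
`FK.apPsiC_lin4_left`, **`FK.apPsiC_level3_eq`** (`x, y, z ∈ M ∖ C`, `f` reading only `x, y, z`:
`apPsiC q M C f g = (d∅+dx+dy+dz)·A_{xyz} − dx·A_{yz} − dy·A_{xz} − dz·A_{xy}`, `A_T = apPsiC q M C 1_{T⊆·} g`), `FK.apPsiC_level1_eq`,
`FK.apPsiC_pivot_eq_ands`, `FK.apPsiC_pivot_split_eq_ands`; and the inputs at any position of any cell: **`FK.apPsiC_pivot_sub_nonpos_of_isTTSP`**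
(gen 11's Theorem U in every cell, re-rooted), **`FK.apPsiC_andSet_sub_nonpos_of_isTTSP`** (file 32c's AND theorem in every cell, re-rooted).
File 45b combines them with file 44b's U¹¹ into level ≤ 3 in EVERY cell.
[cite: Grimmett2006, §1.4 eq. (1.20) (p. 15); §3.8 Thm. (3.90) (pp. 61–62); §3.9 (pp. 63–64)] [cite: Wagner2006, Thm. 5.8(d), §5.3]
-/

noncomputable section

namespace Summit.CriticalPhenomena.PercolationContinuityZ3.Theorems

namespace FK

open Literature.Probability.LatticeModels Literature.Probability.Percolation
open scoped Classical

variable {V : Type*}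

/-! ### Algebra of the minor form -/

section Algebra

/-- `apPsiC` is symmetric in its two test functions. [folklore] -/
theorem apPsiC_comm (q : ℝ) (M C : Finset (Sym2 V)) (f g : Finset (Sym2 V) → ℝ) : apPsiC q M C f g = apPsiC q M C g f := by
  unfold apPsiC
  exact Finset.sum_congr rfl fun γ _ => by ring

/-- `apPsiC` sees only the odd part of `f` along the complementary pairs `(γ ∪ C, (M∖γ) ∪ C)`. [folklore] -/
theorem apPsiC_congr_odd (q : ℝ) {M C : Finset (Sym2 V)} {f₁ f₂ : Finset (Sym2 V) → ℝ} (g : Finset (Sym2 V) → ℝ)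
    (h : ∀ γ : Finset (Sym2 V), γ ⊆ M → f₁ (γ ∪ C) - f₁ (M \ γ ∪ C) = f₂ (γ ∪ C) - f₂ (M \ γ ∪ C)) :
    apPsiC q M C f₁ g = apPsiC q M C f₂ g := by
  unfold apPsiC
  exact Finset.sum_congr rfl fun γ hγ => by rw [h γ (Finset.mem_powerset.1 hγ)]

/-- `apPsiC` is linear in `f` (four-term form). [folklore] -/
theorem apPsiC_lin4_left (q : ℝ) (M C : Finset (Sym2 V)) (c₁ c₂ c₃ c₄ : ℝ) (f₁ f₂ f₃ f₄ g : Finset (Sym2 V) → ℝ) :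
    apPsiC q M C (fun A => c₁ * f₁ A + c₂ * f₂ A + c₃ * f₃ A + c₄ * f₄ A) g =
      c₁ * apPsiC q M C f₁ g + c₂ * apPsiC q M C f₂ g + c₃ * apPsiC q M C f₃ g + c₄ * apPsiC q M C f₄ g := by
  unfold apPsiC
  rw [Finset.mul_sum, Finset.mul_sum, Finset.mul_sum, Finset.mul_sum, ← Finset.sum_add_distrib, ← Finset.sum_add_distrib,
    ← Finset.sum_add_distrib]
  exact Finset.sum_congr rfl fun γ _ => by ring

/-- `apPsiC` is homogeneous in `f`. [folklore] -/
theorem apPsiC_smul_left (q : ℝ) (M C : Finset (Sym2 V)) (c : ℝ) (f g : Finset (Sym2 V) → ℝ) :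
    apPsiC q M C (fun A => c * f A) g = c * apPsiC q M C f g := by
  unfold apPsiC
  rw [Finset.mul_sum]
  exact Finset.sum_congr rfl fun γ _ => by ring

/-- **The odd-vector reduction at level 3, with a contracted set.**  For `x, y, z ∈ M`, none in `C`, and `f` reading only `x, y, z`:
`apPsiC q M C f g = (d∅+dx+dy+dz)·A_{xyz} − dx·A_{yz} − dy·A_{xz} − dz·A_{xy}` (`A_T = apPsiC q M C 1_{T⊆·} g`; `d∅ = f{x,y,z} − f∅`,
`dx = f{x} − f{y,z}`, `dy = f{y} − f{x,z}`, `dz = f{z} − f{x,y}`). [folklore] -/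
theorem apPsiC_level3_eq (q : ℝ) {M C : Finset (Sym2 V)} {x y z : Sym2 V} (hx : x ∈ M) (hy : y ∈ M) (hz : z ∈ M)
    (hxC : x ∉ C) (hyC : y ∉ C) (hzC : z ∉ C) {f : Finset (Sym2 V) → ℝ}
    (hf : ∀ e : Sym2 V, e ∉ ({x, y, z} : Finset (Sym2 V)) → ∀ A : Finset (Sym2 V), f (insert e A) = f A)
    (g : Finset (Sym2 V) → ℝ) :
    apPsiC q M C f g =
      (f {x, y, z} - f ∅ + (f {x} - f {y, z}) + (f {y} - f {x, z}) + (f {z} - f {x, y})) *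
          apPsiC q M C (fun A => if ({x, y, z} : Finset (Sym2 V)) ⊆ A then 1 else 0) g -
        (f {x} - f {y, z}) * apPsiC q M C (fun A => if ({y, z} : Finset (Sym2 V)) ⊆ A then 1 else 0) g -
        (f {y} - f {x, z}) * apPsiC q M C (fun A => if ({x, z} : Finset (Sym2 V)) ⊆ A then 1 else 0) g -
        (f {z} - f {x, y}) * apPsiC q M C (fun A => if ({x, y} : Finset (Sym2 V)) ⊆ A then 1 else 0) g := by
  have hfS := eq_inter_of_notRead_outside hf
  rw [show (f {x, y, z} - f ∅ + (f {x} - f {y, z}) + (f {y} - f {x, z}) + (f {z} - f {x, y})) *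
          apPsiC q M C (fun A => if ({x, y, z} : Finset (Sym2 V)) ⊆ A then 1 else 0) g -
        (f {x} - f {y, z}) * apPsiC q M C (fun A => if ({y, z} : Finset (Sym2 V)) ⊆ A then 1 else 0) g -
        (f {y} - f {x, z}) * apPsiC q M C (fun A => if ({x, z} : Finset (Sym2 V)) ⊆ A then 1 else 0) g -
        (f {z} - f {x, y}) * apPsiC q M C (fun A => if ({x, y} : Finset (Sym2 V)) ⊆ A then 1 else 0) g =
      apPsiC q M C (fun A =>
        (f {x, y, z} - f ∅ + (f {x} - f {y, z}) + (f {y} - f {x, z}) + (f {z} - f {x, y})) *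
            (if ({x, y, z} : Finset (Sym2 V)) ⊆ A then 1 else 0) +
          (-(f {x} - f {y, z})) * (if ({y, z} : Finset (Sym2 V)) ⊆ A then 1 else 0) +
          (-(f {y} - f {x, z})) * (if ({x, z} : Finset (Sym2 V)) ⊆ A then 1 else 0) +
          (-(f {z} - f {x, y})) * (if ({x, y} : Finset (Sym2 V)) ⊆ A then 1 else 0)) g by
    rw [apPsiC_lin4_left]; ring]
  refine apPsiC_congr_odd q g fun γ hγ => ?_
  have hxc : x ∈ M \ γ ↔ x ∉ γ := by rw [Finset.mem_sdiff]; exact ⟨fun h => h.2, fun h => ⟨hx, h⟩⟩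
  have hyc : y ∈ M \ γ ↔ y ∉ γ := by rw [Finset.mem_sdiff]; exact ⟨fun h => h.2, fun h => ⟨hy, h⟩⟩
  have hzc : z ∈ M \ γ ↔ z ∉ γ := by rw [Finset.mem_sdiff]; exact ⟨fun h => h.2, fun h => ⟨hz, h⟩⟩
  rw [hfS (γ ∪ C), hfS (M \ γ ∪ C), Finset.inter_comm (γ ∪ C), Finset.inter_comm (M \ γ ∪ C)]
  by_cases a : x ∈ γ <;> by_cases b : y ∈ γ <;> by_cases c : z ∈ γ <;>
  simp only [Finset.inter_insert, Finset.singleton_inter, Finset.mem_union, hxc, hyc, hzc, hxC, hyC, hzC, a, b, c,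
    Finset.insert_empty, Finset.insert_subset_iff, Finset.singleton_subset_iff, or_false, if_true, if_false,
    not_true_eq_false, not_false_eq_true, and_true, and_false, and_self] <;> ring

/-- **Level 1 with a contracted set**: `f` reading only `x ∈ M ∖ C` ⟹ `apPsiC q M C f g = (f{x} − f∅)·apPsiC q M C 1_x g`. [folklore] -/
theorem apPsiC_level1_eq (q : ℝ) {M C : Finset (Sym2 V)} {x : Sym2 V} (hx : x ∈ M) (hxC : x ∉ C) {f : Finset (Sym2 V) → ℝ}
    (hf : ∀ e : Sym2 V, e ∉ ({x} : Finset (Sym2 V)) → ∀ A : Finset (Sym2 V), f (insert e A) = f A) (g : Finset (Sym2 V) → ℝ) :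
    apPsiC q M C f g = (f {x} - f ∅) * apPsiC q M C (fun A => if x ∈ A then 1 else 0) g := by
  have hfS := eq_inter_of_notRead_outside hf
  rw [← apPsiC_smul_left]
  refine apPsiC_congr_odd q g fun γ _ => ?_
  have hxc : x ∈ M \ γ ↔ x ∉ γ := by rw [Finset.mem_sdiff]; exact ⟨fun h => h.2, fun h => ⟨hx, h⟩⟩
  rw [hfS (γ ∪ C), hfS (M \ γ ∪ C), Finset.inter_comm (γ ∪ C), Finset.inter_comm (M \ γ ∪ C)]
  by_cases a : x ∈ γ <;>
  simp only [Finset.singleton_inter, Finset.mem_union, hxc, hxC, a, or_false, if_true, if_false,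
    not_true_eq_false, not_false_eq_true] <;> ring

/-- **Theorem U as a relation among AND functionals, with a contracted set.** [folklore] -/
theorem apPsiC_pivot_eq_ands (q : ℝ) {M C : Finset (Sym2 V)} {x y z : Sym2 V} (hx : x ∈ M) (hy : y ∈ M) (hz : z ∈ M)
    (hxC : x ∉ C) (hyC : y ∉ C) (hzC : z ∉ C) (hxy : x ≠ y) (hxz : x ≠ z) (g : Finset (Sym2 V) → ℝ) :
    apPsiC q M C (fun A => if x ∈ A then 1 else 0) g =
      apPsiC q M C (fun A => if ({x, y} : Finset (Sym2 V)) ⊆ A then 1 else 0) g +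
          apPsiC q M C (fun A => if ({x, z} : Finset (Sym2 V)) ⊆ A then 1 else 0) g -
        apPsiC q M C (fun A => if ({y, z} : Finset (Sym2 V)) ⊆ A then 1 else 0) g := by
  have key := apPsiC_level3_eq q hx hy hz hxC hyC hzC (f := fun A => if x ∈ A then (1 : ℝ) else 0)
    (fun e he A => by
      have hex : x ≠ e := fun h => he (h ▸ by simp)
      simp only [Finset.mem_insert, hex, false_or]) g
  rw [key]
  simp only [Finset.mem_insert, Finset.mem_singleton, hxy, hxz, or_false, or_self, if_true, if_false, Finset.notMem_empty]
  ring

/-- Moving the split indicator from the `g`-side to the `f`-side, with a contracted set (`y, z ∈ M ∖ C`). [folklore] -/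
theorem apPsiC_pivot_split_eq_left (q : ℝ) {M C : Finset (Sym2 V)} {x y z : Sym2 V} (hy : y ∈ M) (hz : z ∈ M) (hyC : y ∉ C)
    (hzC : z ∉ C) (g : Finset (Sym2 V) → ℝ) :
    apPsiC q M C (fun A => if x ∈ A then 1 else 0) (fun A => splitInd y z A * g A) =
      apPsiC q M C (fun A => (if x ∈ A then 1 else 0) * splitInd y z A) g := by
  unfold apPsiC
  refine Finset.sum_congr rfl fun γ _ => ?_
  have hyc : y ∈ M \ γ ↔ y ∉ γ := by rw [Finset.mem_sdiff]; exact ⟨fun h => h.2, fun h => ⟨hy, h⟩⟩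
  have hzc : z ∈ M \ γ ↔ z ∉ γ := by rw [Finset.mem_sdiff]; exact ⟨fun h => h.2, fun h => ⟨hz, h⟩⟩
  have hsp : splitInd y z (M \ γ ∪ C) = splitInd y z (γ ∪ C) := by
    unfold splitInd
    by_cases b : y ∈ γ <;> by_cases c : z ∈ γ <;>
    simp only [Finset.mem_union, hyc, hzc, hyC, hzC, b, c, or_false, not_true_eq_false, not_false_eq_true, iff_true,
      iff_false, if_true, if_false]
  dsimp only
  rw [hsp]
  ring

/-- **U¹¹ as a relation among AND functionals, with a contracted set.** [folklore] -/
theorem apPsiC_pivot_split_eq_ands (q : ℝ) {M C : Finset (Sym2 V)} {x y z : Sym2 V} (hx : x ∈ M) (hy : y ∈ M) (hz : z ∈ M)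
    (hxC : x ∉ C) (hyC : y ∉ C) (hzC : z ∉ C) (hxy : x ≠ y) (hxz : x ≠ z) (hyz : y ≠ z) (g : Finset (Sym2 V) → ℝ) :
    apPsiC q M C (fun A => if x ∈ A then 1 else 0) (fun A => splitInd y z A * g A) =
      apPsiC q M C (fun A => if ({x, y} : Finset (Sym2 V)) ⊆ A then 1 else 0) g +
          apPsiC q M C (fun A => if ({x, z} : Finset (Sym2 V)) ⊆ A then 1 else 0) g -
        2 * apPsiC q M C (fun A => if ({x, y, z} : Finset (Sym2 V)) ⊆ A then 1 else 0) g := by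
  rw [apPsiC_pivot_split_eq_left q hy hz hyC hzC]
  have key := apPsiC_level3_eq q hx hy hz hxC hyC hzC (f := fun A => (if x ∈ A then (1 : ℝ) else 0) * splitInd y z A)
    (fun e he A => by
      have hex : x ≠ e := fun h => he (h ▸ by simp)
      have hey : e ≠ y := fun h => he (h ▸ by simp)
      have hez : e ≠ z := fun h => he (h ▸ by simp)
      simp only [Finset.mem_insert, hex, false_or, splitInd_insert_of_ne hey hez]) g
  rw [key]
  unfold splitInd
  simp only [Finset.mem_insert, Finset.mem_singleton, hxy, hxz, hyz, hxy.symm, hxz.symm, hyz.symm, or_true, or_false,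
    or_self, if_true, if_false, Finset.notMem_empty, not_true_eq_false, not_false_eq_true, iff_true, iff_false]
  ring

end Algebra

/-! ### Theorem U and AND at any position, in every cell -/

section Inputs

variable [Fintype V] {s t : V}

omit [Fintype V] in
/-- A function not reading the edges of `C` ignores them: `g X = g (X \ C)`. [folklore] -/
theorem eq_sdiff_of_notRead {g : Finset (Sym2 V) → ℝ} {C : Finset (Sym2 V)} (hg : ∀ e ∈ C, ∀ A : Finset (Sym2 V), g (insert e A) = g A)
    (X : Finset (Sym2 V)) : g X = g (X \ C) := by
  have h := notRead_union hg (X ∩ C) Finset.inter_subset_right (X \ C)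
  rw [Finset.sdiff_union_inter] at h
  exact h

/-- **Theorem U at any edge of any cell** (`0 < q ≤ 1`): `M, C ⊆ E ∪ {st}` disjoint, `a ∈ M`, `g` monotone on the subsets of `M` not reading `a`
nor the edges of `C` ⟹ `apPsiC q M C 1_a g ≤ 0` (re-root at `a`; gen 11's `FK.apPsiC_edge_nonpos_of_isTTSP`).
[cite: Grimmett2006, §3.8 Thm. (3.90) (pp. 61–62); §3.9 (pp. 63–64)] -/
theorem apPsiC_pivot_sub_nonpos_of_isTTSP {q : ℝ} (hq0 : 0 < q) (hq1 : q ≤ 1) {E : Finset (Sym2 V)} (hE : IsTTSP E s t)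
    (hst : s(s, t) ∉ E) {M C : Finset (Sym2 V)} (hM : M ⊆ insert s(s, t) E) (hC : C ⊆ insert s(s, t) E) (hMC : Disjoint M C)
    {a : Sym2 V} (ha : a ∈ M) {g : Finset (Sym2 V) → ℝ} (hga : ∀ A : Finset (Sym2 V), g (insert a A) = g A)
    (hgC : ∀ e ∈ C, ∀ A : Finset (Sym2 V), g (insert e A) = g A)
    (hmono : ∀ ⦃A B : Finset (Sym2 V)⦄, A ⊆ B → B ⊆ M → g A ≤ g B) :
    apPsiC q M C (fun A => if a ∈ A then 1 else 0) g ≤ 0 := by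
  induction a using Sym2.ind with
  | h a₁ a₂ =>
    have hR := hE.reroot_erase (hM ha) (insert_ne_singleton_of_isTTSP hE hst _)
    have haC : s(a₁, a₂) ∉ C := fun h => Finset.disjoint_left.1 hMC ha h
    have hMa : M.erase s(a₁, a₂) ⊆ (insert s(s, t) E).erase s(a₁, a₂) := Finset.erase_subset_erase _ hM
    have hCa : C ⊆ (insert s(s, t) E).erase s(a₁, a₂) := fun e he => Finset.mem_erase.2 ⟨fun h => haC (h ▸ he), hC he⟩
    have key := apPsiC_edge_nonpos_of_isTTSP hq0 hq1 hR hMa hCa (Finset.notMem_erase _ _) haC hga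
      (fun A B hAB hB => by
        rw [eq_sdiff_of_notRead hgC A, eq_sdiff_of_notRead hgC B]
        refine hmono (Finset.sdiff_subset_sdiff hAB le_rfl) fun e he => ?_
        have he' := Finset.mem_sdiff.1 he
        rcases Finset.mem_union.1 (hB he'.1) with h | h
        · exact Finset.mem_of_mem_erase h
        · exact absurd h he'.2)
    rw [Finset.insert_erase ha] at key
    exact key

/-- **AND of any nonempty edge set in any cell** (`0 < q ≤ 1`): `M, C ⊆ E ∪ {st}` disjoint, `∅ ≠ S ⊆ M`, `g` monotone on the subsets of `M`
not reading `S` nor the edges of `C` ⟹ `apPsiC q M C 1_{S ⊆ ·} g ≤ 0` (re-root at an edge of `S`; file 32c's `FK.apPsiC_and_nonpos_of_isTTSP`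
applied to `X ↦ g (X ∩ M)`). [cite: Grimmett2006, §3.8 Thm. (3.90) (pp. 61–62); §3.9 (pp. 63–64)] -/
theorem apPsiC_andSet_sub_nonpos_of_isTTSP {q : ℝ} (hq0 : 0 < q) (hq1 : q ≤ 1) {E : Finset (Sym2 V)} (hE : IsTTSP E s t)
    (hst : s(s, t) ∉ E) {M C : Finset (Sym2 V)} (hM : M ⊆ insert s(s, t) E) (hC : C ⊆ insert s(s, t) E) (hMC : Disjoint M C)
    {S : Finset (Sym2 V)} (hS : S ⊆ M) (hSne : S.Nonempty)
    {g : Finset (Sym2 V) → ℝ} (hg : ∀ e ∈ S, ∀ A : Finset (Sym2 V), g (insert e A) = g A)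
    (hgC : ∀ e ∈ C, ∀ A : Finset (Sym2 V), g (insert e A) = g A)
    (hmono : ∀ ⦃X Y : Finset (Sym2 V)⦄, X ⊆ Y → Y ⊆ M → g X ≤ g Y) :
    apPsiC q M C (fun X => if S ⊆ X then 1 else 0) g ≤ 0 := by
  -- replace g by X ↦ g (X ∩ M), which is globally monotone and agrees with g on the arguments γ ∪ C
  have hswap : apPsiC q M C (fun X => if S ⊆ X then 1 else 0) g = apPsiC q M C (fun X => if S ⊆ X then 1 else 0) (fun X => g (X ∩ M)) := by
    unfold apPsiC
    refine Finset.sum_congr rfl fun γ hγ => ?_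
    have hγM := Finset.mem_powerset.1 hγ
    have hCM : C ∩ M = ∅ := Finset.disjoint_iff_inter_eq_empty.1 hMC.symm
    have e1 : (γ ∪ C) ∩ M = γ := by rw [Finset.union_inter_distrib_right, Finset.inter_eq_left.2 hγM, hCM, Finset.union_empty]
    have e2 : (M \ γ ∪ C) ∩ M = M \ γ := by
      rw [Finset.union_inter_distrib_right, Finset.inter_eq_left.2 Finset.sdiff_subset, hCM, Finset.union_empty]
    have e3 : (γ ∪ C) \ C = γ := by
      rw [Finset.union_sdiff_distrib, Finset.sdiff_self, Finset.union_empty]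
      exact Finset.sdiff_eq_self_of_disjoint (Finset.disjoint_of_subset_left hγM hMC)
    have e4 : (M \ γ ∪ C) \ C = M \ γ := by
      rw [Finset.union_sdiff_distrib, Finset.sdiff_self, Finset.union_empty]
      exact Finset.sdiff_eq_self_of_disjoint (Finset.disjoint_of_subset_left Finset.sdiff_subset hMC)
    dsimp only
    rw [e1, e2, eq_sdiff_of_notRead hgC (γ ∪ C), eq_sdiff_of_notRead hgC (M \ γ ∪ C), e3, e4]
  rw [hswap]
  obtain ⟨a, ha⟩ := hSne
  induction a using Sym2.ind with
  | h a₁ a₂ =>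
    have haM : s(a₁, a₂) ∈ M := hS ha
    have hR := hE.reroot_erase (hM haM) (insert_ne_singleton_of_isTTSP hE hst _)
    have haC : s(a₁, a₂) ∉ C := fun h => Finset.disjoint_left.1 hMC haM h
    have hT : S.erase s(a₁, a₂) ⊆ (insert s(s, t) E).erase s(a₁, a₂) := Finset.erase_subset_erase _ (hS.trans hM)
    have hN : M \ S ⊆ (insert s(s, t) E).erase s(a₁, a₂) := fun e he => by
      have he' := Finset.mem_sdiff.1 he
      exact Finset.mem_erase.2 ⟨fun h => he'.2 (h ▸ ha), hM he'.1⟩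
    have hCa : C ⊆ (insert s(s, t) E).erase s(a₁, a₂) := fun e he => Finset.mem_erase.2 ⟨fun h => haC (h ▸ he), hC he⟩
    have hSeq : insert s(a₁, a₂) (S.erase s(a₁, a₂)) = S := Finset.insert_erase ha
    have hMeq : M \ S ∪ insert s(a₁, a₂) (S.erase s(a₁, a₂)) = M := by rw [hSeq, Finset.sdiff_union_of_subset hS]
    have key := apPsiC_and_nonpos_of_isTTSP hq0 hq1 hR (Finset.notMem_erase _ _) hN hT hCa
      (Finset.disjoint_of_subset_right (Finset.erase_subset _ _) Finset.sdiff_disjoint)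
      (Finset.disjoint_of_subset_left Finset.sdiff_subset hMC)
      (Finset.disjoint_of_subset_left ((Finset.erase_subset _ _).trans hS) hMC)
      (g := fun X => g (X ∩ M))
      (fun A U hU => by
        show g ((A ∪ U) ∩ M) = g (A ∩ M)
        rw [Finset.union_inter_distrib_right]
        exact notRead_union hg (U ∩ M) (fun e he => hSeq ▸ hU (Finset.mem_inter.1 he).1) (A ∩ M))
      (fun X Y hXY => hmono (Finset.inter_subset_inter hXY le_rfl) Finset.inter_subset_right)
    rw [hMeq, hSeq] at key
    exact key

end Inputs

end FK

end Summit.CriticalPhenomena.PercolationContinuityZ3.Theorems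

end
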